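/-
Origin: expansion seat `planner-pub-hodgecm-toy2-g3-0`, handover #5 2026-08-18T06:50:57Z (`HOME/pub-hodgecm-toy2-g3/lean/Toy2g3/TruncAlgCM.lean`, md5 d055a2d4, 158 lines);
landed by the gen-7 packager in gate run 25 as `HodgeCM/Model/Toy/TruncAlgCM.lean` (import ^import Toy2g3\.(TruncAlgMilne|TruncAlgAtExt|TruncAlgAt|TruncAlgDual|TruncAlgCM|TruncAlgExt)\b→import HodgeCM.Model.Toy.\1 ×1).
-/
/-
Copyright: pub-hodgecm formalisation cell (harness21, 2026). New file (not vendored).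
Origin: HOME/pub-hodgecm-toy2-g3/lean/Toy2g3/TruncAlgCM.lean — session planner-pub-hodgecm-toy2-g3-0 (unit pub-hodgecm-toy2-g3,
CONSISTENCY seat 2, part (6a)(i)+(ii), generation 3).  WIP module `Toy2g3.TruncAlgCM`; intended final place
`HodgeCM/Model/Toy/TruncAlgCM.lean` (module `HodgeCM.Model.Toy.TruncAlgCM`; kind L5 consistency / non-vacuity layer).
WIP import to rewrite on landing: `import Toy2g3.TruncAlgAt` ↦ `import HodgeCM.Model.Toy.TruncAlgAt` (this seat, HANDOVER #3).
-/
import Summits.HodgeConjecture.HodgeCM.Model.Toy.TruncAlgAt_2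

/-!
# `HC_CM` itself is not a finite-codimension statement: the cyclotomic tower `ℚ(ζ_p)` in the truncations

`HodgeCM.Model.Toy.TruncAlgAt` showed that for every `c` the truncation `truncModelAt c` (algebraic classes cut to
codimension `≤ c`) is a model of the 28 facts + Pohlmann + `W_RK4` with the Hodge conjecture through codimension `c` in
which the FACE REDUCTION and [QW8] sufficiency fail — the witnesses being powers `A_{(ℚ(ζ₇),Φ)}^{k+1}`, which are CM
products but not CM atoms, so `HC_CM` (quantified over `IsCMAbelianVariety`, in the toy: the atoms `A_{(K,Φ)}`) was
refuted only at `c = 2` (by the `3`-fold `A_{(ℚ(ζ₇),Φ)}`).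

This file removes that restriction with the cyclotomic tower: for a prime `p ≥ 7` the field `ℚ(ζ_p)` is a Galois CM
field of degree `p - 1` (`cyclo`, `cyclo_isGalois`, `cyclo_finrank` — Mathlib's `IsCyclotomicExtension.Rat.isCMField`,
`.isGalois`, `.finrank`), the CM atom `A_{(ℚ(ζ_p),Φ)}` has dimension `(p-1)/2`, and its top class is a nonzero Hodge
class (`hodgeClassesOf_single_ne_bot`, from M, N1–N4) of codimension `(p-1)/2 > c` once `p > 2c + 1`; there
`(U.truncAlgAt c).alg = ⊥`.  Hence (generic) `not_hc_cm_truncAlgAt : ∀ c, ¬ (U.truncAlgAt c).HC_CM` for every model `U`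
of M + N1–N4, and (toy) **`hc_cm_not_finite_codimension`**: for every `c` a model of `ModelAxioms ∧ PohlmannSpan ∧
PohlmannBasis ∧ W_RK4 ∧ N1–N4 ∧ F5 ∧ F7d ∧ Fact_dimProd ∧ Lemma81 ∧ HCUpTo c` in which `HC_CM` FAILS — on the simple CM
abelian variety `A_{(ℚ(ζ_p), Φ_std)}`, `p` the least prime `≥ 2c + 7`.  By-products: the face hypotheses of `perL` are
inhabited over every `ℚ(ζ_p)`, `p ≥ 7` prime (`faceHypothesesInhabited_cyclo`), so `FaceHypothesesInhabited` has
witnesses of unbounded degree.  All proofs kernel-checked; no cited facts.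
-/

noncomputable section

namespace HodgeCM

open Literature.AlgebraicGeometry.Motives (CMType)
open NumberField

/-! ## 1. The cyclotomic CM fields `ℚ(ζ_n)`, `n > 2` -/

/- As for `cyclo7` (`Model/Inhabited.lean`): the `ℚ`-algebra structure of `CyclotomicField n ℚ` registered for the
cyclotomic-extension instance and the one found on a bare field agree definitionally but not at instance transparency. -/
set_option backward.isDefEq.respectTransparency false in
/-- (Ported verbatim from the HodgeCMPerL package; no docstring in the source.) -/
theorem cyclotomicField_isCMField (n : ℕ) (hn : 2 < n) : IsCMField (CyclotomicField n ℚ) :=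
  IsCyclotomicExtension.Rat.isCMField (CyclotomicField n ℚ) (S := ({n} : Set ℕ)) ⟨n, Set.mem_singleton n, hn⟩

/-- `ℚ(ζ_n)` (`n > 2`) as a bundled CM field. -/
def cyclo (n : ℕ) (hn : 2 < n) : CMField :=
  @CMField.mk (CyclotomicField n ℚ) _ _ (cyclotomicField_isCMField n hn)

set_option backward.isDefEq.respectTransparency false in
/-- (Ported verbatim from the HodgeCMPerL package; no docstring in the source.) -/
theorem cyclo_isGalois (n : ℕ) (hn : 2 < n) : IsGalois ℚ (cyclo n hn) :=
  IsCyclotomicExtension.isGalois {n} ℚ (CyclotomicField n ℚ)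

set_option backward.isDefEq.respectTransparency false in
/-- `[ℚ(ζ_p) : ℚ] = p - 1` for a prime `p`. -/
theorem cyclo_finrank {p : ℕ} (hp : p.Prime) (h2 : 2 < p) : Module.finrank ℚ (cyclo p h2) = p - 1 := by
  haveI : NeZero p := ⟨hp.ne_zero⟩
  have h := IsCyclotomicExtension.finrank (n := p) (K := ℚ) (CyclotomicField p ℚ)
    (Polynomial.cyclotomic.irreducible_rat hp.pos)
  rw [Nat.totient_prime hp] at h
  exact h

/-- For every bound there is a Galois CM field of larger degree (and degree `≥ 6`): `ℚ(ζ_p)`, `p` prime. -/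
theorem exists_cmField_finrank_gt (b : ℕ) :
    ∃ F : CMField, IsGalois ℚ F ∧ 6 ≤ Module.finrank ℚ F ∧ b < Module.finrank ℚ F := by
  obtain ⟨p, hle, hp⟩ := Nat.exists_infinite_primes (b + 7)
  refine ⟨cyclo p (by omega), cyclo_isGalois p _, ?_, ?_⟩
  · rw [cyclo_finrank hp]; omega
  · rw [cyclo_finrank hp]; omega

/-- The face hypotheses of `perL` are inhabited over every `ℚ(ζ_p)`, `p ≥ 7` prime. -/
theorem faceHypothesesInhabited_cyclo {p : ℕ} (hp : p.Prime) (h7 : 7 ≤ p) :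
    ∃ (f : Face (cyclo p (by omega))) (ι₁ : (cyclo p (by omega) : Type) →+* ℂ), f.Admissible ι₁ :=
  exists_face_admissible _ (by rw [cyclo_finrank hp]; omega)

namespace Universe

variable {U : Universe}

/-! ## 2. Generic: `HC_CM` fails in every truncation -/

/-- **`HC_CM` FAILS in `U.truncAlgAt c` for EVERY `c`** (for `U` with `ModelAxioms`, N1–N4): the top class of the CM atom
`A_{(ℚ(ζ_p),Φ)}`, `p` prime `≥ 2c + 7`, is a nonzero Hodge class of codimension `(p-1)/2 > c`. -/
theorem not_hc_cm_truncAlgAt (M : U.ModelAxioms) (hN1 : U.Fact_cupExterior) (hN2 : U.Fact_cup_hodge)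
    (hN3 : U.Fact_pull_H0) (hN4 : U.Fact_hodge_F0) (c : ℕ) : ¬ (U.truncAlgAt c).HC_CM := by
  obtain ⟨F, hG, h6, hc⟩ := exists_cmField_finrank_gt (2 * c + 1)
  haveI := hG
  have hc' : c < Module.finrank ℚ F / 2 := by omega
  intro h
  exact not_hc_truncAlgAt_of_ne_bot hc' (hodgeClassesOf_single_ne_bot M hN1 hN2 hN3 hN4 h6 (stdCMType F))
    (h _ (M.cmAV F (stdCMType F)).2.1)

/-- Hence no truncation of such a model satisfies `HC_CM`, although `truncAlgAt c` satisfies `HCUpTo c` whenever `U`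
satisfies the Hodge conjecture. -/
theorem not_hc_cm_truncAlgAt_and_hcUpTo (M : U.ModelAxioms) (hN1 : U.Fact_cupExterior) (hN2 : U.Fact_cup_hodge)
    (hN3 : U.Fact_pull_H0) (hN4 : U.Fact_hodge_F0) (hHC : ∀ X : U.Var, U.HC X) (c : ℕ) :
    (U.truncAlgAt c).HCUpTo c ∧ ¬ (U.truncAlgAt c).HC_CM :=
  ⟨(U.truncAlgAt_hcUpTo_iff c).mpr (U.hcUpTo_of_hc hHC c), not_hc_cm_truncAlgAt M hN1 hN2 hN3 hN4 c⟩

end Universe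

/-! ## 3. Toy: `HC_CM` is not a finite-codimension statement -/

namespace Toy

open Universe

/-- **`HC_CM` FAILS in every `truncModelAt c`.** -/
theorem not_truncModelAt_hc_cm (c : ℕ) : ¬ (truncModelAt c).HC_CM :=
  not_hc_cm_truncAlgAt toyModel_modelAxioms toyModel_fact_cupExterior toyModel_fact_cup_hodge toyModel_fact_pull_H0
    toyModel_fact_hodge_F0 c

/-- **The Hodge conjecture for CM abelian varieties is not a finite-codimension statement over the model facts**: for
every `c` there is a model of the 28 facts with Pohlmann's theorem (both forms), `W_RK4`, N1–N4, F5, F7d, `Fact_dimProd`,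
`Lemma81` and the Hodge conjecture through codimension `c` on ALL varieties, in which `HC_CM` fails — on a simple CM
abelian variety `A_{(ℚ(ζ_p),Φ)}` — together with the face reduction, [QW8] sufficiency and F4. -/
theorem hc_cm_not_finite_codimension (c : ℕ) :
    ∃ U : Universe, U.ModelAxioms ∧ U.PohlmannSpan ∧ U.PohlmannBasis ∧ U.W_RK4 ∧ U.Fact_cupExterior ∧ U.Fact_cup_hodge ∧
      U.Fact_pull_H0 ∧ U.Fact_hodge_F0 ∧ U.Fact_cupAssoc ∧ U.Fact_gysinDescent ∧ U.Fact_dimProd ∧ U.Lemma81 ∧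
      U.HCUpTo c ∧ ¬ U.HC_CM ∧ ¬ U.FaceReduction ∧ ¬ U.Qw8Sufficiency ∧ ¬ U.Fact_cupAlg := by
  have hc : 2 ≤ max c 2 := le_max_right _ _
  exact ⟨truncModelAt (max c 2), truncModelAt_modelAxioms hc, truncModelAt_pohlmannSpan _, truncModelAt_pohlmannBasis _,
    truncModelAt_w_rk4 hc, truncModelAt_fact_cupExterior _, truncModelAt_fact_cup_hodge _, truncModelAt_fact_pull_H0 _,
    truncModelAt_fact_hodge_F0 _, truncModelAt_fact_cupAssoc _, truncModelAt_fact_gysinDescent _,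
    truncModelAt_fact_dimProd _, truncModelAt_lemma81 _,
    (truncModelAt (max c 2)).hcUpTo_mono (truncModelAt_hcUpTo _) (le_max_left _ _), not_truncModelAt_hc_cm _,
    not_truncModelAt_faceReduction hc, not_truncModelAt_qw8Sufficiency hc, not_truncModelAt_fact_cupAlg hc⟩

/-- The same, read as a non-implication: **no `HCUpTo c` implies `HC_CM`** over `ModelAxioms ∧ PohlmannSpan ∧ PohlmannBasis ∧
W_RK4`. -/
theorem not_hc_cm_of_hcUpTo (c : ℕ) :
    ¬ ∀ U : Universe, U.ModelAxioms → U.PohlmannSpan → U.PohlmannBasis → U.W_RK4 → U.HCUpTo c → U.HC_CM := by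
  intro h
  obtain ⟨U, hM, hP, hB, hW, -, -, -, -, -, -, -, -, hc, hF, -⟩ := hc_cm_not_finite_codimension c
  exact hF (h U hM hP hB hW hc)

/-- **Every model of the infinite family refutes `HC_CM`**: the injective family `k ↦ truncModelAt (3k+2)` of
`truncModelAt_injective` consists of models of the 28 facts + Pohlmann + `W_RK4` + `Lemma81` with `¬ HC_CM`. -/
theorem infinitely_many_models_not_hc_cm :
    ∃ g : ℕ → Universe, Function.Injective g ∧
      ∀ k, (g k).ModelAxioms ∧ (g k).PohlmannSpan ∧ (g k).PohlmannBasis ∧ (g k).W_RK4 ∧ (g k).Lemma81 ∧ ¬ (g k).HC_CM :=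
  ⟨fun k => truncModelAt (3 * k + 2), truncModelAt_injective, fun k =>
    have hc : 2 ≤ 3 * k + 2 := by omega
    ⟨truncModelAt_modelAxioms hc, truncModelAt_pohlmannSpan _, truncModelAt_pohlmannBasis _, truncModelAt_w_rk4 hc,
      truncModelAt_lemma81 _, not_truncModelAt_hc_cm _⟩⟩

/-- The set of models of `ModelAxioms ∧ PohlmannSpan ∧ PohlmannBasis ∧ W_RK4 ∧ ¬ HC_CM` is infinite. -/
theorem models_not_hc_cm_infinite :
    {U : Universe | U.ModelAxioms ∧ U.PohlmannSpan ∧ U.PohlmannBasis ∧ U.W_RK4 ∧ ¬ U.HC_CM}.Infinite := by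
  obtain ⟨g, hg, h⟩ := infinitely_many_models_not_hc_cm
  exact Set.infinite_of_injective_forall_mem hg fun k =>
    ⟨(h k).1, (h k).2.1, (h k).2.2.1, (h k).2.2.2.1, (h k).2.2.2.2.2⟩

end Toy

end HodgeCM

end
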